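import Summits.BirchSwinnertonDyer.Rank1Residual.Additive.QuadraticBranchLower
import Summits.BirchSwinnertonDyer.Rank1Residual.Additive.ChiBranchLowerInput
import Summits.BirchSwinnertonDyer.Rank1Residual.Additive.ChiBranchLowerInputOdd
import HarnessLib

/-!
# The LOWER half at the Λ-level: DESCENT of our quadratic-branch conjecture on `E♭` over
# `ℚ(μ_{p^∞})` to the `W`-level typed inputs of `ChiBranchLowerInput.lean`
# (cell `b2b-bsdres`, team n1011, seat p10, row T-c2 (i)/(iii); sequel of `QuadraticBranchLower.lean`)

HONEST FRAMING (cell `b2b-bsdres`, run/shared/lean/b2b/bsd-rank1-residual/, verbatim in every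
file): the goal of the cell is to DELETE the COMBINATION-SHAPED residual classes of the
Birch–Swinnerton-Dyer formula for ALL analytic-rank `≤ 1` elliptic curves over `ℚ` — "full BSD
formula for every rank `≤ 1` curve in class `C`" assembled STRICTLY from published theorems — so
that the rank-`≤ 1` remainder becomes exactly the CONSTRUCTION-SHAPED classes, which are TYPED
(missing-input `Prop`s), NOT attempted. This is not "finishing BSD". Team n1011 (RESIDUAL-MAP §I
N10 / N11): research route on the CONSTRUCTION-SHAPED items N10/N11; they stay CONSTRUCTION;
nothing is booked; no label moves. Theorems only (no definition, no named fact): pure compositions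
of the cell's kernel descent with OUR conjecture `QuadraticBranchLowerDivisibilityAt` (an
`@[conjecture] def`, NOT in print, nothing asserted) taken as an explicit hypothesis.

## What this file proves

Seat p07 (`ChiBranchLowerInput.lean`) typed the Skinner–Urban direction on the `χ_{p*}`-branch AT
THE LEVEL OF THE ADDITIVE CURVE `W = E♭ ⊗ χ_{p*}`: `ChiBranchLowerDivisibilityAt W p` (Λ-adic, good
ordinary twist, `p ≡ 1 (mod 4)`) and `ChiBranchLowerLeadingTerm[Odd]At W p` (`T = 0`). The sibling
`QuadraticBranchLower.lean` types the SAME conjecture one level up, where the literature lives: on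
the `ω^{(p−1)/2}`-eigencomponent of `Sel_{p^∞}(E♭/ℚ(μ_{p^∞}))` (`QuadraticBranchLowerDivisibilityAt V p`,
binders of the tree's Kato–Wuthrich fact with the conclusion reversed). Here the two are joined by
the kernel descent `X(E/ℚ_∞) ≅ e_{(p−1)/2}X(E♭/ℚ(μ_{p^∞}))` of additive-p1/p2 (Greenberg LNM 1716
§5; `SelmerDualData.exists_chiEigenInCyclotomic`: same characteristic ideal at a normalised
generator), exactly as additive-p2's `chiBranchLeadingTerm[Odd]BigImageAt_of_katoComponent` does for
the Euler-system direction: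

* `chiBranchLowerDivisibilityAt_of_quadraticBranchLower` — OUR conjecture for every good ordinary
  `E♭` with `E ≅ E♭ ⊗ χ_{p*}` ⟹ `ChiBranchLowerDivisibilityAt W p` (`p ≡ 1 (mod 4)`); its odd twin
  `chiBranchLowerDivisibilityOddAt_of_quadraticBranchLower` ⟹ p07's `ChiBranchLowerDivisibilityOddAt W p`
  (`ChiBranchLowerInputOdd.lean`, `p ≡ 3 (mod 4)`);
* `chiBranchLowerLeadingTermAt_of_quadraticBranchLower_of_padicValRat_j_nonneg` (even branch) and
  `chiBranchLowerLeadingTermOddAt_of_quadraticBranchLower_of_padicValRat_j_nonneg` (odd branch,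
  `p = 3` included) — the `T = 0` inputs on a potentially GOOD `W` (`0 ≤ ord_p j`), whence (seat p07,
  `ChiBranchLowerTransport.lean`) `CycLowerLeadingTermAt W p` and, with the EXACT algebraic leading
  term (team files `CycLeadingTermDvd.lean` / `N10LowerHalfIwasawa.lean`), the Miller-currency LOWER
  half `Typed.MissingLowerBoundAt W p` on the (G-ord, `e = 2`) rows — the end-to-end composition is
  the sequel (T-c2 (iii)); the (M) rows need the multiplicative constant terms
  (`constantCoeff_padicLFunction{Plus,Minus}BranchMult_half`) and are left to that sequel too.

References: Greenberg 1999 [GreenbergLNM1716] §5; Mazur–Tate–Teitelbaum 1986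
[MazurTateTeitelbaum1986Invent] §I.14; Skinner–Urban 2014 [SkinnerUrban2014] Thm. 3.6.4 (shape
only); Kato 2004 [Kato2004Asterisque] Thm. 17.4 (3) (binder shape only).
-/

noncomputable section

open scoped Classical MatrixGroups ModularForm

open CongruenceSubgroup WeierstrassCurve Literature.NumberTheory.EllipticCurves
  Literature.NumberTheory.EllipticCurves.ModularForms
  Literature.NumberTheory.EllipticCurves.Rank1Residual
  Literature.NumberTheory.GaloisRepresentations

namespace Summit.BirchSwinnertonDyer.Rank1Residual.Additive

/-! ### §4 The descended `W`-level forms (seat p07's typed inputs) from the conjecture -/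

section Descent

variable (W : WeierstrassCurve ℚ) [W.IsElliptic] (p : ℕ) [hp : Fact p.Prime]

omit [W.IsElliptic] in
/-- **Λ-level descent, even branch: OUR conjecture for every good ordinary `E♭` with
`E ≅ E♭ ⊗ χ_p` implies `ChiBranchLowerDivisibilityAt W p`** (seat p07's `W`-level typed input,
`p ≡ 1 (mod 4)`): the prime-to-`p` descent `X(E/ℚ_∞) ≅ e_{(p−1)/2}X(E♭/ℚ(μ_{p^∞}))` in the kernel
(additive-p2's `SelmerDualData.exists_chiEigenInCyclotomic`: a `Λ`-dual datum `D` of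
`Sel_{p^∞}(E/ℚ_∞)` yields an eigen-datum `D'` over `F·K·ℚ_∞ = ℚ(μ_{p^∞})` at a normalised
generator with the SAME characteristic ideal), exactly as in additive-p2's
`chiBranchLeadingTermBigImageAt_of_katoComponent` with the divisibility REVERSED.
[cite: GreenbergLNM1716, §5 (PDF p. 143)] [cite: SkinnerUrban2014, Thm. 3.6.4 (p. 43) (shape only; nothing asserted)] -/
theorem chiBranchLowerDivisibilityAt_of_quadraticBranchLower
    (hc : ∀ (V : WeierstrassCurve ℚ) [V.IsElliptic] [V.IsGloballyMinimal],
      (∃ C : VariableChange ℚ, C • V.quadraticTwist ((-1) ^ (p / 2) * p : ℚ) = W) →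
        QuadraticBranchLowerDivisibilityAt V p) :
    ChiBranchLowerDivisibilityAt W p := by
  intro V _ _ κ γ N _ f hp1 hCW hord hκ hγ hcv hf D ϖ hϖ g hg
  have hp2 : p ≠ 2 := by rintro rfl; norm_num at hp1
  have hpne : (p : ℚ) ≠ 0 := Nat.cast_ne_zero.mpr hp.out.ne_zero
  have heven : Even (p / 2) := ⟨p / 4, by omega⟩
  obtain ⟨C, hC⟩ := hCW
  have hcV : QuadraticBranchLowerDivisibilityAt V p :=
    hc V ⟨C, by rw [pStar_eq_self_of_mod_four_eq_one hp1]; exact hC⟩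
  haveI hcycL : IsCyclotomicExtension {p} ℚ (CyclotomicField p ℚ) := by
    have h : (CyclotomicField.algebra p ℚ : Algebra ℚ (CyclotomicField p ℚ)) =
        DivisionRing.toRatAlgebra := Subsingleton.elim _ _
    exact h ▸ CyclotomicField.isCyclotomicExtension p ℚ
  obtain ⟨K, θ, hK2, hθ, hθ2⟩ := exists_intermediateField_sq_eq_pStar p (CyclotomicField p ℚ) hp2
  haveI : NumberField K := NumberField.of_module_finite ℚ K
  have hcK : θ ^ 2 = algebraMap ℚ K (p : ℚ) := by
    rw [hθ2, pStar_eq_self_of_mod_four_eq_one hp1]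
  haveI : IsGalois ℚ K := isGalois_of_finrank_eq_two K hK2
  haveI := normal_galRange K hK2 (sigmaQ_ne_one K hK2 hθ hcK)
  haveI := normal_galRange_cyclotomic p (CyclotomicField p ℚ)
  haveI : (V.quadraticTwist (p : ℚ)).IsElliptic := V.isElliptic_quadraticTwist hpne
  obtain ⟨γ', hγ'KF, hκγ', ⟨g₀, hg₀, hγ'eq⟩, D', hchar, -⟩ :=
    SelmerDualData.exists_chiEigenInCyclotomic p (CyclotomicField p ℚ) V K hK2 hθ hcK κ hC hp2 D
  have hg' : g ∈ Literature.NumberTheory.EllipticCurves.Module.charIdeal (IwasawaAlgebra p) D'.X := by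
    rw [hchar]; exact hg
  obtain ⟨h, hιg⟩ := hcV K (CyclotomicField p ℚ) (κ := κ) (γ := γ') (f := f)
    (padicLFunctionBranch f ((unitRoot V p : ℤ_[p]) : ℚ_[p]) (p / 2)) hp2 hK2 ⟨θ, hθ2⟩
    (Or.inl ⟨hord, by rw [if_pos heven]⟩) hκ (isTopGenerator_of_kappa_eq κ hκγ' hγ)
    (isCyclotomicVariable_of_eq_mul p κ hκ hg₀ hγ'eq hcv)
    (Subgroup.mem_inf.mp hγ'KF).1 (Subgroup.mem_inf.mp hγ'KF).2 hf D' ϖ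
    (by rw [if_pos heven]; exact hϖ) g hg'
  exact ⟨h, hιg⟩


omit [W.IsElliptic] in
/-- **Λ-level descent, ODD branch (`p ≡ 3 (mod 4)`, `p = 3` included): OUR conjecture for every good
ordinary `E♭` with `E ≅ E♭ ⊗ χ_{−p}` implies seat p07's `ChiBranchLowerDivisibilityOddAt W p`**
(`ChiBranchLowerInputOdd.lean`) — same descent as the even branch, MINUS branch and minus period.
[cite: GreenbergLNM1716, §5 (PDF p. 143)] [cite: SkinnerUrban2014, Thm. 3.6.4 (p. 43) (shape only; nothing asserted)] -/
theorem chiBranchLowerDivisibilityOddAt_of_quadraticBranchLower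
    (hc : ∀ (V : WeierstrassCurve ℚ) [V.IsElliptic] [V.IsGloballyMinimal],
      (∃ C : VariableChange ℚ, C • V.quadraticTwist ((-1) ^ (p / 2) * p : ℚ) = W) →
        QuadraticBranchLowerDivisibilityAt V p) :
    ChiBranchLowerDivisibilityOddAt W p := by
  intro V _ _ κ γ N _ f hp3 hCW hord hκ hγ hcv hf D ϖ hϖ g hg
  have hp2 : p ≠ 2 := by rintro rfl; norm_num at hp3
  have hpne : (-(p : ℚ)) ≠ 0 := neg_ne_zero.mpr (Nat.cast_ne_zero.mpr hp.out.ne_zero)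
  have hodd : ¬ Even (p / 2) := by rw [Nat.not_even_iff_odd]; exact ⟨p / 4, by omega⟩
  obtain ⟨C, hC⟩ := hCW
  have hcV : QuadraticBranchLowerDivisibilityAt V p :=
    hc V ⟨C, by rw [pStar_eq_neg_of_mod_four_eq_three hp3]; exact hC⟩
  haveI hcycL : IsCyclotomicExtension {p} ℚ (CyclotomicField p ℚ) := by
    have h : (CyclotomicField.algebra p ℚ : Algebra ℚ (CyclotomicField p ℚ)) =
        DivisionRing.toRatAlgebra := Subsingleton.elim _ _
    exact h ▸ CyclotomicField.isCyclotomicExtension p ℚ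
  obtain ⟨K, θ, hK2, hθ, hθ2⟩ := exists_intermediateField_sq_eq_pStar p (CyclotomicField p ℚ) hp2
  haveI : NumberField K := NumberField.of_module_finite ℚ K
  have hcK : θ ^ 2 = algebraMap ℚ K (-(p : ℚ)) := by
    rw [hθ2, pStar_eq_neg_of_mod_four_eq_three hp3]
  haveI : IsGalois ℚ K := isGalois_of_finrank_eq_two K hK2
  haveI := normal_galRange K hK2 (sigmaQ_ne_one K hK2 hθ hcK)
  haveI := normal_galRange_cyclotomic p (CyclotomicField p ℚ)
  haveI : (V.quadraticTwist (-(p : ℚ))).IsElliptic := V.isElliptic_quadraticTwist hpne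
  obtain ⟨γ', hγ'KF, hκγ', ⟨g₀, hg₀, hγ'eq⟩, D', hchar, -⟩ :=
    SelmerDualData.exists_chiEigenInCyclotomic p (CyclotomicField p ℚ) V K hK2 hθ hcK κ hC hp2 D
  have hg' : g ∈ Literature.NumberTheory.EllipticCurves.Module.charIdeal (IwasawaAlgebra p) D'.X := by
    rw [hchar]; exact hg
  obtain ⟨h, hιg⟩ := hcV K (CyclotomicField p ℚ) (κ := κ) (γ := γ') (f := f)
    (padicLFunctionMinusBranch f ((unitRoot V p : ℤ_[p]) : ℚ_[p]) (p / 2)) hp2 hK2 ⟨θ, hθ2⟩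
    (Or.inl ⟨hord, by rw [if_neg hodd]⟩) hκ (isTopGenerator_of_kappa_eq κ hκγ' hγ)
    (isCyclotomicVariable_of_eq_mul p κ hκ hg₀ hγ'eq hcv)
    (Subgroup.mem_inf.mp hγ'KF).1 (Subgroup.mem_inf.mp hγ'KF).2 hf D' ϖ
    (by rw [if_neg hodd]; exact hϖ) g hg'
  exact ⟨h, hιg⟩

/-- **`T = 0`, even branch, potentially GOOD `W`: OUR conjecture implies
`ChiBranchLowerLeadingTermAt W p`** — by the Λ-level descent above and seat p07's
`chiBranchLowerLeadingTermAt_of_divisibility_of_padicValRat_j_nonneg` (a multiplicative twist datum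
cannot occur when `0 ≤ ord_p j(W)`). [cite: MazurTateTeitelbaum1986Invent, §I.14]
[cite: SkinnerUrban2014, Thm. 3.6.4 (p. 43) (shape only; nothing asserted)] -/
theorem chiBranchLowerLeadingTermAt_of_quadraticBranchLower_of_padicValRat_j_nonneg
    (hj : 0 ≤ padicValRat p W.j)
    (hc : ∀ (V : WeierstrassCurve ℚ) [V.IsElliptic] [V.IsGloballyMinimal],
      (∃ C : VariableChange ℚ, C • V.quadraticTwist ((-1) ^ (p / 2) * p : ℚ) = W) →
        QuadraticBranchLowerDivisibilityAt V p) :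
    ChiBranchLowerLeadingTermAt W p :=
  chiBranchLowerLeadingTermAt_of_divisibility_of_padicValRat_j_nonneg p W hj
    (chiBranchLowerDivisibilityAt_of_quadraticBranchLower W p hc)

/-- **`T = 0`, ODD branch (`p ≡ 3 (mod 4)`, `p = 3` included), potentially GOOD `W`: OUR conjecture
implies `ChiBranchLowerLeadingTermOddAt W p`** (seat p07's typed input): descent as above, then
the `E♭`-level constant term (`QuadraticBranchLower.constantCoeff_of_goodOrd_odd`); a multiplicative
twist datum is excluded by `0 ≤ ord_p j(W)` (`EisensteinPrimes.padicValRat_j_neg_of_mult`).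
[cite: MazurTateTeitelbaum1986Invent, §I.14] [cite: GreenbergLNM1716, §5 (PDF p. 143)] -/
theorem chiBranchLowerLeadingTermOddAt_of_quadraticBranchLower_of_padicValRat_j_nonneg
    (hj : 0 ≤ padicValRat p W.j)
    (hc : ∀ (V : WeierstrassCurve ℚ) [V.IsElliptic] [V.IsGloballyMinimal],
      (∃ C : VariableChange ℚ, C • V.quadraticTwist ((-1) ^ (p / 2) * p : ℚ) = W) →
        QuadraticBranchLowerDivisibilityAt V p) :
    ChiBranchLowerLeadingTermOddAt W p := by
  intro V _ _ κ γ N _ f hp3 hCW hred hκ hγ hcv hf D ϖ hϖ g hg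
  have hp2 : p ≠ 2 := by rintro rfl; norm_num at hp3
  have hpne : (-(p : ℚ)) ≠ 0 := neg_ne_zero.mpr (Nat.cast_ne_zero.mpr hp.out.ne_zero)
  -- `V` is good ordinary (a multiplicative twist datum would force `ord_p j(W) < 0`)
  have hord : IsOrdinaryAt V p := isOrdinaryAt_of_goodOrd_or_mult_of_model_twist W V hpne hCW hj hred
  obtain ⟨C, hC⟩ := hCW
  have hcV : QuadraticBranchLowerDivisibilityAt V p :=
    hc V ⟨C, by rw [pStar_eq_neg_of_mod_four_eq_three hp3]; exact hC⟩
  haveI hcycL : IsCyclotomicExtension {p} ℚ (CyclotomicField p ℚ) := by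
    have h : (CyclotomicField.algebra p ℚ : Algebra ℚ (CyclotomicField p ℚ)) =
        DivisionRing.toRatAlgebra := Subsingleton.elim _ _
    exact h ▸ CyclotomicField.isCyclotomicExtension p ℚ
  obtain ⟨K, θ, hK2, hθ, hθ2⟩ := exists_intermediateField_sq_eq_pStar p (CyclotomicField p ℚ) hp2
  haveI : NumberField K := NumberField.of_module_finite ℚ K
  have hcK : θ ^ 2 = algebraMap ℚ K (-(p : ℚ)) := by
    rw [hθ2, pStar_eq_neg_of_mod_four_eq_three hp3]
  haveI : IsGalois ℚ K := isGalois_of_finrank_eq_two K hK2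
  haveI := normal_galRange K hK2 (sigmaQ_ne_one K hK2 hθ hcK)
  haveI := normal_galRange_cyclotomic p (CyclotomicField p ℚ)
  haveI : (V.quadraticTwist (-(p : ℚ))).IsElliptic := V.isElliptic_quadraticTwist hpne
  obtain ⟨γ', hγ'KF, hκγ', ⟨g₀, hg₀, hγ'eq⟩, D', hchar, -⟩ :=
    SelmerDualData.exists_chiEigenInCyclotomic p (CyclotomicField p ℚ) V K hK2 hθ hcK κ hC hp2 D
  have hg' : g ∈ Literature.NumberTheory.EllipticCurves.Module.charIdeal (IwasawaAlgebra p) D'.X := by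
    rw [hchar]; exact hg
  exact QuadraticBranchLower.constantCoeff_of_goodOrd_odd hcV K (CyclotomicField p ℚ) hp3 hK2 ⟨θ, hθ2⟩
    hord hκ (isTopGenerator_of_kappa_eq κ hκγ' hγ) (isCyclotomicVariable_of_eq_mul p κ hκ hg₀ hγ'eq hcv)
    (Subgroup.mem_inf.mp hγ'KF).1 (Subgroup.mem_inf.mp hγ'KF).2 hf D' ϖ hϖ hg'

end Descent

end Summit.BirchSwinnertonDyer.Rank1Residual.Additive

end
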